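import Summits.ResolutionOfSingularities.ResolutionOfSingularities.Theorems.FrobeniusLadderFInjectiveMacaulayficationF108ToricStage

/-!
# [OURS · L1 W4.5a · F-108 toric infrastructure 5/7] The construction: from the fan of the blown-up origin through all generators

* `initCone`, `initState` — the `n` decorated cones of the fan of `Bl₀ 𝔸ⁿ` (rays `𝟙` and `e_j`, `j ≠ l`; vertex `e_l`; dual basis
  `e_l`, `e_j − e_l`), and ★ `inv_initState`: they satisfy the invariant bundle;
* `good_initState` — they are good for `𝒜₀ = {N₀ e_l}` (the support function `N₀ · min_j w_j`);
* ★ `exists_inv_good` — iterating the stage of file 4/7 over the elements of a finite set `E ⊆ ℕⁿ` yields a state with `Inv` all of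
  whose cones are `Good (𝒜₀ ∪ E)`; ★ `exists_inv_good_convenient` — if `E` contains a pure power `c·e_l` with `0 < c < N₀` of every
  variable (CONVENIENCE), the cones are `Good E`: a unimodular projective fan refining the Newton fan of `E` and the fan of `Bl₀ 𝔸ⁿ`,
  with all the decorations.
AI-written; weaker than expert review. Nothing here proves resolution of singularities in positive characteristic.
-/

set_option linter.dupNamespace false

noncomputable section

namespace Summit.ResolutionOfSingularities.ResolutionOfSingularities.Theorems.FInjectiveMacaulayfication.F108Toric

open Matrix Finset

variable {n : ℕ}

/-! ## The initial state: the fan of the blow-up of the origin -/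

/-- The decorated cone `D_l` of the fan of `Bl₀ 𝔸ⁿ`: slot `l` carries `𝟙 = (1,…,1)`, slot `j ≠ l` carries `e_j`; vertex `e_l`
(support function `min_j w_j`); dual basis `w l = e_l`, `w j = e_j − e_l`. [OURS · bookkeeping] -/
def initCone (n : ℕ) (l : Fin n) : DCone n where
  ray := fun i => if i = l then (fun _ => 1) else Pi.single i 1
  m := Pi.single l 1
  w := fun i => if i = l then Pi.single l 1 else Pi.single i 1 - Pi.single l 1
  l := l

/-- The initial state `Σ(𝔪)`. [OURS · bookkeeping] -/
def initState (n : ℕ) : Finset (DCone n) := univ.image (initCone n)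

/-- Membership in the initial state. -/
theorem mem_initState {d : DCone n} : d ∈ initState n ↔ ∃ l, d = initCone n l := by
  simp [initState, eq_comm]

/-- The ray in slot `l` of `D_l` is `𝟙`. -/
theorem initCone_ray_self (l : Fin n) : (initCone n l).ray l = fun _ => 1 := by simp [initCone]

/-- The ray in slot `i ≠ l` of `D_l` is `e_i`. -/
theorem initCone_ray_of_ne {l i : Fin n} (h : i ≠ l) : (initCone n l).ray i = Pi.single i 1 := by simp [initCone, h]

/-- The ray set of `D_l`. -/
theorem mem_rays_initCone {l : Fin n} {ρ : Fin n → ℤ} :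
    ρ ∈ (initCone n l).rays ↔ ρ = (fun _ => 1) ∨ ∃ i, i ≠ l ∧ ρ = Pi.single i 1 := by
  rw [mem_rays]
  constructor
  · rintro ⟨i, rfl⟩
    by_cases h : i = l
    · left; rw [h, initCone_ray_self]
    · right; exact ⟨i, h, initCone_ray_of_ne h⟩
  · rintro (rfl | ⟨i, hi, rfl⟩)
    · exact ⟨l, initCone_ray_self l⟩
    · exact ⟨i, initCone_ray_of_ne hi⟩

/-- `𝟙 ⬝ᵥ e_j = 1`. -/
theorem ones_dotProduct_single (j : Fin n) : (fun _ => (1 : ℤ)) ⬝ᵥ Pi.single j 1 = 1 := by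
  rw [dotProduct_single, mul_one]

/-- `e_i ≠ 𝟙` when there is another index. -/
theorem single_ne_ones {i l : Fin n} (h : i ≠ l) : (Pi.single i 1 : Fin n → ℤ) ≠ fun _ => 1 := by
  intro heq
  have := congrFun heq l
  simp [Ne.symm h] at this

/-- ★ The initial state satisfies the invariant bundle (`n ≥ 1`). -/
theorem inv_initState (hn : 0 < n) : Inv (initState n) := by
  classical
  have hray : ∀ (l i : Fin n) (j : Fin n), (initCone n l).ray i j = if i = l then 1 else if j = i then 1 else 0 := by
    intro l i j; by_cases h : i = l
    · simp [h, initCone_ray_self]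
    · simp [initCone_ray_of_ne h, h, Pi.single_apply]
  refine
    { nonneg := ?_, stdOrPos := ?_, dual := ?_, lmin := ?_, bdry := ?_, mnonneg := ?_, mlpos := ?_, sc := ?_, dom := ?_,
      amem := ?_, complete := ?_ }
  · intro d hd i j; obtain ⟨l, rfl⟩ := mem_initState.1 hd
    rw [hray]; split_ifs <;> omega
  · intro d hd i; obtain ⟨l, rfl⟩ := mem_initState.1 hd
    by_cases h : i = l
    · right; intro j; rw [hray, if_pos h]
    · left; exact ⟨i, initCone_ray_of_ne h⟩
  · intro d hd i j; obtain ⟨l, rfl⟩ := mem_initState.1 hd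
    show (initCone n l).ray j ⬝ᵥ (initCone n l).w i = _
    have hw : (initCone n l).w i = if i = l then Pi.single l 1 else Pi.single i 1 - Pi.single l 1 := rfl
    rw [hw]
    by_cases hj : j = l
    · rw [hj, initCone_ray_self]
      by_cases hi : i = l
      · rw [if_pos hi, ones_dotProduct_single, if_pos (hi.trans rfl)]
      · rw [if_neg hi, dotProduct_sub, ones_dotProduct_single, ones_dotProduct_single, if_neg hi, sub_self]
    · rw [initCone_ray_of_ne hj]
      by_cases hi : i = l
      · rw [if_pos hi, single_dotProduct, one_mul, Pi.single_apply, if_neg hj, if_neg (fun h => hj (h.symm.trans hi))]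
      · rw [if_neg hi, single_dotProduct, one_mul, Pi.sub_apply, Pi.single_apply, Pi.single_apply, if_neg hj]
        by_cases hij : i = j
        · rw [if_pos hij.symm, if_pos hij]; ring
        · rw [if_neg (fun h => hij h.symm), if_neg hij]; ring
  · intro d hd i j; obtain ⟨l, rfl⟩ := mem_initState.1 hd
    show (initCone n l).ray i l ≤ _
    rw [hray, hray]; split_ifs <;> omega
  · intro d hd i hz; obtain ⟨l, rfl⟩ := mem_initState.1 hd
    show (initCone n l).ray i ⬝ᵥ Pi.single l 1 = 0
    by_cases h : i = l
    · exfalso; obtain ⟨j, hj⟩ := hz; rw [hray, if_pos h] at hj; exact one_ne_zero hj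
    · rw [initCone_ray_of_ne h, single_dotProduct, one_mul, Pi.single_apply, if_neg h]
  · intro d hd j; obtain ⟨l, rfl⟩ := mem_initState.1 hd
    show 0 ≤ (Pi.single l (1 : ℤ) : Fin n → ℤ) j
    rw [Pi.single_apply]; split_ifs <;> omega
  · intro d hd; obtain ⟨l, rfl⟩ := mem_initState.1 hd
    show 1 ≤ (Pi.single l (1 : ℤ) : Fin n → ℤ) l
    simp
  · intro d hd d' hd' i; obtain ⟨l, rfl⟩ := mem_initState.1 hd; obtain ⟨l', rfl⟩ := mem_initState.1 hd'
    show (initCone n l).ray i ⬝ᵥ (Pi.single l' 1 - Pi.single l 1) = 0 ↔ (initCone n l).ray i ∈ (initCone n l').rays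
    rw [dotProduct_sub, mem_rays_initCone]
    by_cases h : i = l
    · rw [h, initCone_ray_self, ones_dotProduct_single, ones_dotProduct_single, sub_self]
      simp
    · rw [initCone_ray_of_ne h, single_dotProduct, single_dotProduct, one_mul, one_mul, Pi.single_apply, Pi.single_apply,
        if_neg h]
      constructor
      · intro h0
        right; refine ⟨i, fun hil => ?_, rfl⟩
        rw [if_pos hil] at h0; simp at h0
      · rintro (h1 | ⟨i', hi', h2⟩)
        · exact absurd h1 (single_ne_ones h)
        · have hii' : i = i' := by
            by_contra hne; have := congrFun h2 i; simp [hne] at this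
          subst hii'; rw [if_neg hi', sub_zero]
  · intro d hd d' hd' i; obtain ⟨l, rfl⟩ := mem_initState.1 hd; obtain ⟨l', rfl⟩ := mem_initState.1 hd'
    show (initCone n l).ray i l' - (initCone n l).ray i l ≤ (initCone n l).ray i ⬝ᵥ (Pi.single l' 1 - Pi.single l 1)
    rw [dotProduct_sub, dotProduct_single, dotProduct_single, mul_one, mul_one]
  · intro d hd i; obtain ⟨l, rfl⟩ := mem_initState.1 hd
    by_cases h : i = l
    · left
      intro d'' hd'' j; obtain ⟨l'', rfl⟩ := mem_initState.1 hd''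
      show (initCone n l'').ray j l - (initCone n l'').ray j l'' ≤
        (initCone n l'').ray j ⬝ᵥ (Pi.single l 1 + (initCone n l).w i - Pi.single l'' 1)
      have hw : (initCone n l).w i = Pi.single l 1 := by simp [initCone, h]
      rw [hw, dotProduct_sub, dotProduct_add, dotProduct_single, dotProduct_single, mul_one, mul_one]
      have : 0 ≤ (initCone n l'').ray j l := by rw [hray]; split_ifs <;> omega
      linarith
    · right
      exact ⟨i, by simp [initCone, h]⟩
  · intro x hx
    obtain ⟨l, -, hl⟩ := exists_min_image univ x (univ_nonempty_iff.2 ⟨⟨0, hn⟩⟩)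
    refine ⟨initCone n l, mem_initState.2 ⟨l, rfl⟩, fun i => if i = l then x l else x i - x l, ?_, ?_⟩
    · intro i; dsimp only; by_cases h : i = l
      · rw [if_pos h]; exact hx l
      · rw [if_neg h]; linarith [hl i (mem_univ i)]
    · funext j
      rw [Finset.sum_apply]
      have hterm : ∀ i, (((if i = l then x l else x i - x l) • (initCone n l).ray i) : Fin n → ℤ) j
          = if i = l then x l else (x i - x l) * (if j = i then 1 else 0) := by
        intro i
        simp only [Pi.smul_apply, smul_eq_mul]
        rw [hray]
        by_cases h : i = l
        · rw [if_pos h, if_pos h, if_pos h, mul_one]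
        · rw [if_neg h, if_neg h, if_neg h]
      rw [sum_congr rfl fun i _ => hterm i, ← Finset.add_sum_erase _ _ (mem_univ l), if_pos rfl]
      have hrest : ∑ i ∈ univ.erase l, (if i = l then x l else (x i - x l) * (if j = i then 1 else 0))
          = ∑ i ∈ univ.erase l, (x i - x l) * (if j = i then 1 else 0) :=
        sum_congr rfl fun i hi => by rw [if_neg (ne_of_mem_erase hi)]
      rw [hrest, Finset.sum_mul_boole]
      by_cases hj : j = l
      · rw [hj, if_neg (by simp)]; ring
      · rw [if_pos (mem_erase.2 ⟨hj, mem_univ j⟩)]; ring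

/-- The initial cones are good for `𝒜₀ = {N₀ e_l}` (`N₀ ≥ 0`): the common minimiser of `D_l` is `N₀ e_l`. -/
theorem good_initState {N₀ : ℤ} (hN₀ : 0 ≤ N₀) :
    ∀ d ∈ initState n, Good (univ.image fun l : Fin n => N₀ • (Pi.single l 1 : Fin n → ℤ)) d := by
  intro d hd; obtain ⟨l, rfl⟩ := mem_initState.1 hd
  refine ⟨N₀ • Pi.single l 1, mem_image.2 ⟨l, mem_univ l, rfl⟩, fun i b' hb' => ?_⟩
  obtain ⟨l', -, rfl⟩ := mem_image.1 hb'
  rw [dotProduct_smul, dotProduct_smul, dotProduct_single, dotProduct_single, mul_one, mul_one, smul_eq_mul, smul_eq_mul]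
  by_cases h : i = l
  · rw [h, initCone_ray_self]
  · rw [initCone_ray_of_ne h, Pi.single_apply, Pi.single_apply, if_neg (Ne.symm h)]
    split_ifs <;> nlinarith

/-! ## Iterating the stage over the generators -/

/-- The boundary hypothesis of the stage holds as soon as `𝒜 ⊇ {N₀ e_l}`. -/
theorem hA_nonpos_of_zero {𝒜 : Finset (Fin n → ℤ)} {N₀ : ℤ}
    (h𝒜 : ∀ l : Fin n, N₀ • (Pi.single l 1 : Fin n → ℤ) ∈ 𝒜) (ρ : Fin n → ℤ) (hz : ∃ j, ρ j = 0) : hA 𝒜 ρ ≤ 0 := by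
  obtain ⟨j, hj⟩ := hz
  have hne : 𝒜.Nonempty := ⟨_, h𝒜 j⟩
  refine le_trans (hA_le hne (h𝒜 j) ρ) ?_
  rw [dotProduct_smul, dotProduct_single, hj]; simp

/-- ★ Iterating the stage: a state with `Inv` all of whose cones are good for `𝒜₀ ∪ E`. -/
theorem exists_inv_good (hn : 0 < n) {N₀ : ℤ} (hN₀ : 0 ≤ N₀) (E : Finset (Fin n → ℤ)) (hE : ∀ e ∈ E, ∀ j, 0 ≤ e j) :
    ∃ S : Finset (DCone n), Inv S ∧
      ∀ d ∈ S, Good ((univ.image fun l : Fin n => N₀ • (Pi.single l 1 : Fin n → ℤ)) ∪ E) d := by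
  classical
  induction E using Finset.induction_on with
  | empty => exact ⟨initState n, inv_initState hn, by rw [union_empty]; exact good_initState hN₀⟩
  | insert a E ha ih =>
    obtain ⟨S, hS, hg⟩ := ih fun e he => hE e (mem_insert_of_mem he)
    have hmem : ∀ l : Fin n, N₀ • (Pi.single l 1 : Fin n → ℤ) ∈ (univ.image fun l : Fin n => N₀ • (Pi.single l 1 : Fin n → ℤ)) ∪ E :=
      fun l => mem_union_left _ (mem_image.2 ⟨l, mem_univ l, rfl⟩)
    have hne : ((univ.image fun l : Fin n => N₀ • (Pi.single l 1 : Fin n → ℤ)) ∪ E).Nonempty := ⟨_, hmem ⟨0, hn⟩⟩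
    obtain ⟨S', hS', hg'⟩ := stage hne (hE a (mem_insert_self a E)) (fun ρ _ hz => hA_nonpos_of_zero hmem ρ hz) S hS hg
    refine ⟨S', hS', fun d hd => ?_⟩
    rw [union_insert]; exact hg' d hd

/-- In a state, every cone has in every coordinate a ray with positive entry (the ray matrix is invertible). -/
theorem Inv.exists_ray_pos {S : Finset (DCone n)} (hS : Inv S) {d : DCone n} (hd : d ∈ S) (l : Fin n) :
    ∃ i, 1 ≤ d.ray i l := by
  by_contra hno
  have h0 : ∀ i, d.ray i l = 0 := fun i => by
    have := hS.nonneg d hd i l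
    by_contra hne; exact hno ⟨i, by omega⟩
  have h := hS.ray_mul_w_transpose hd
  have h' : (Matrix.of d.w)ᵀ * Matrix.of d.ray = 1 := mul_eq_one_comm.1 h
  have := congrFun (congrFun h' l) l
  rw [Matrix.mul_apply, Matrix.one_apply_eq] at this
  simp only [transpose_apply, of_apply, h0, mul_zero, sum_const_zero] at this
  exact zero_ne_one this

/-- A cone good for `𝒜₀ ∪ E` is good for `E` when `E` is CONVENIENT below `N₀`: the vectors `N₀ e_l` are never common minimisers. -/
theorem Inv.good_of_good_union {S : Finset (DCone n)} (hS : Inv S) {N₀ : ℤ} {E : Finset (Fin n → ℤ)}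
    (hconv : ∀ l : Fin n, ∃ c : ℤ, 0 < c ∧ c < N₀ ∧ c • (Pi.single l 1 : Fin n → ℤ) ∈ E) {d : DCone n} (hd : d ∈ S)
    (hg : Good ((univ.image fun l : Fin n => N₀ • (Pi.single l 1 : Fin n → ℤ)) ∪ E) d) : Good E d := by
  obtain ⟨b, hb, hmin⟩ := hg
  rcases mem_union.1 hb with hb0 | hbE
  · exfalso
    obtain ⟨l, -, rfl⟩ := mem_image.1 hb0
    obtain ⟨c, hc0, hcN, hcE⟩ := hconv l
    obtain ⟨i, hi⟩ := hS.exists_ray_pos hd l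
    have h := hmin i _ (mem_union_right _ hcE)
    rw [dotProduct_smul, dotProduct_smul, dotProduct_single, mul_one, smul_eq_mul, smul_eq_mul] at h
    nlinarith
  · exact ⟨b, hbE, fun i b' hb' => hmin i b' (mem_union_right _ hb')⟩

/-- ★ THE GOOD STATE OF A CONVENIENT EXPONENT SET: for `E ⊆ ℕⁿ` finite containing a pure power of every variable, there is a state
satisfying the invariant bundle all of whose cones have a common minimiser in `E` (a unimodular projective refinement of the Newton fan
of `E` and of the fan of `Bl₀ 𝔸ⁿ`, with its support-function and dual-basis decorations). -/
theorem exists_inv_good_convenient (hn : 0 < n) (E : Finset (Fin n → ℤ)) (hE : ∀ e ∈ E, ∀ j, 0 ≤ e j)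
    (hconv : ∀ l : Fin n, ∃ c : ℤ, 0 < c ∧ c • (Pi.single l 1 : Fin n → ℤ) ∈ E) :
    ∃ S : Finset (DCone n), Inv S ∧ ∀ d ∈ S, Good E d := by
  classical
  choose c hc using hconv
  set N₀ : ℤ := 1 + univ.sup' (univ_nonempty_iff.2 ⟨⟨0, hn⟩⟩) c with hN₀
  have hN₀' : 0 ≤ N₀ := by
    have : c ⟨0, hn⟩ ≤ univ.sup' (univ_nonempty_iff.2 ⟨⟨0, hn⟩⟩) c := le_sup' c (mem_univ _)
    linarith [(hc ⟨0, hn⟩).1]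
  obtain ⟨S, hS, hg⟩ := exists_inv_good hn hN₀' E hE
  refine ⟨S, hS, fun d hd => hS.good_of_good_union (N₀ := N₀) (fun l => ⟨c l, (hc l).1, ?_, (hc l).2⟩) hd (hg d hd)⟩
  have : c l ≤ univ.sup' (univ_nonempty_iff.2 ⟨⟨0, hn⟩⟩) c := le_sup' c (mem_univ l)
  linarith

end Summit.ResolutionOfSingularities.ResolutionOfSingularities.Theorems.FInjectiveMacaulayfication.F108Toric

end
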